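import Mathlib
import HarnessLib

/-!
# Stub `stub_newmanRotate` of the line `potential-flow-essential-singularity`
# (crux `MarginalStabilityChain.StretchedVortexRows`, stmt-AnomalousDissipation-3009)

Sorry-free discharge of the registered stub `stub_newmanRotate` of the lead's skeleton: the line of
integration in Newman's entire function `N(z) = ∫_ℝ K(z, t) dt` with the entire kernel
`K(z, ζ) = exp(z e^ζ - ζ e^ζ + ζ)` (D. J. Newman, *An entire function bounded in every direction*,
Amer. Math. Monthly 83 (1976) 192–193; in the variable `s = e^ζ` this is `∫₀^∞ e^{zs} s^{-s} ds`)
may be shifted from `Im ζ = 0` to `Im ζ = φ` for every `|φ| < π / 2`: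
`∫_ℝ K(z, τ) dτ = ∫_ℝ K(z, τ + iφ) dτ`.

**Proof outline** (the pattern of Mathlib's `GaussianFourier.integral_cexp_neg_mul_sq_add_real_mul_I`).
* `newmanRotate_norm_kernel`: for real `τ, ψ`,
  `‖K(z, τ + iψ)‖ = exp(e^τ ((Re z - τ) cos ψ - (Im z - ψ) sin ψ) + τ)`, whence the crude bound
  `≤ exp(e^τ (|Re z| + |Im z| + |ψ| - τ cos ψ) + τ)` (`newmanRotate_norm_kernel_le`).
* Consequently `‖K(z, τ + iψ)‖ ≤ e^{-τ}` as soon as `|Re z| + |Im z| + |ψ| + 2 ≤ τ cos ψ`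
  (`newmanRotate_norm_le_exp_neg`, using `τ + 1 ≤ e^τ`), and `‖K(z, τ + iψ)‖ ≤ exp(|Re z| + |Im z| + |ψ| + 1 + τ)`
  for `τ ≤ 0` (`newmanRotate_norm_le_exp`, using `|τ| e^τ ≤ 1`).
* Hence `τ ↦ K(z, τ + iψ)` is integrable on `ℝ` whenever `cos ψ > 0` (`newmanRotate_integrable`:
  `O(e^τ)` on `(-∞, 0]`, continuous on `[0, T₁]`, `≤ e^{-τ}` on `(T₁, ∞)`), and the integrals of `K`
  over the vertical sides `±T + i[0, φ]` of the rectangle `[-T, T] × [0, φ]` tend to `0` as `T → ∞`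
  (`newmanRotate_tendsto_right`, `newmanRotate_tendsto_left`; on `[0, φ]` one has `cos y ≥ cos φ > 0`).
* `newmanRotate_shift`: for an entire `f` with these four properties, Cauchy–Goursat on the rectangles
  (`Complex.integral_boundary_rect_eq_zero_of_differentiableOn`) and
  `MeasureTheory.intervalIntegral_tendsto_integral` + `tendsto_nhds_unique` give `∫ f(x) dx = ∫ f(x + iφ) dx`.

No named facts are used; everything is Mathlib.
-/

set_option linter.dupNamespace false

noncomputable section

open scoped Topology ENNReal Real
open Filter Set Function MeasureTheory Complex

namespace Summit.AnomalousDissipation.AnomalousDissipation.Theorems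
namespace MarginalStabilityChainStretchedVortexRows
namespace PotentialFlow

/-! ## The modulus of Newman's kernel on horizontal lines -/

/-- Exact modulus of Newman's kernel `K(z, ζ) = exp(z e^ζ - ζ e^ζ + ζ)` at `ζ = τ + iψ`:
`‖K(z, τ + iψ)‖ = exp(e^τ((Re z - τ) cos ψ - (Im z - ψ) sin ψ) + τ)`. [folklore] -/
theorem newmanRotate_norm_kernel (z : ℂ) (τ ψ : ℝ) :
    ‖Complex.exp (z * Complex.exp ((τ : ℂ) + ψ * I) -
        ((τ : ℂ) + ψ * I) * Complex.exp ((τ : ℂ) + ψ * I) + ((τ : ℂ) + ψ * I))‖ =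
      Real.exp (Real.exp τ * ((z.re - τ) * Real.cos ψ - (z.im - ψ) * Real.sin ψ) + τ) := by
  rw [Complex.norm_exp]
  congr 1
  simp only [add_re, sub_re, mul_re, exp_re, exp_im, add_im, mul_im, ofReal_re, ofReal_im, I_re,
    I_im, mul_zero, mul_one, sub_zero, add_zero, zero_add]
  ring

/-- Crude upper bound for the modulus of Newman's kernel on the line `Im ζ = ψ`:
`‖K(z, τ + iψ)‖ ≤ exp(e^τ(|Re z| + |Im z| + |ψ| - τ cos ψ) + τ)`. [folklore] -/
theorem newmanRotate_norm_kernel_le (z : ℂ) (τ ψ : ℝ) :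
    ‖Complex.exp (z * Complex.exp ((τ : ℂ) + ψ * I) -
        ((τ : ℂ) + ψ * I) * Complex.exp ((τ : ℂ) + ψ * I) + ((τ : ℂ) + ψ * I))‖ ≤
      Real.exp (Real.exp τ * (|z.re| + |z.im| + |ψ| - τ * Real.cos ψ) + τ) := by
  rw [newmanRotate_norm_kernel, Real.exp_le_exp]
  have h1 : z.re * Real.cos ψ ≤ |z.re| := by
    calc z.re * Real.cos ψ ≤ |z.re * Real.cos ψ| := le_abs_self _
      _ = |z.re| * |Real.cos ψ| := abs_mul _ _
      _ ≤ |z.re| * 1 := by gcongr; exact Real.abs_cos_le_one ψ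
      _ = |z.re| := mul_one _
  have h2 : -((z.im - ψ) * Real.sin ψ) ≤ |z.im| + |ψ| := by
    calc -((z.im - ψ) * Real.sin ψ) ≤ |(z.im - ψ) * Real.sin ψ| := neg_le_abs _
      _ = |z.im - ψ| * |Real.sin ψ| := abs_mul _ _
      _ ≤ (|z.im| + |ψ|) * 1 := by
          gcongr
          · exact abs_sub _ _
          · exact Real.abs_sin_le_one ψ
      _ = |z.im| + |ψ| := mul_one _
  have h3 : (z.re - τ) * Real.cos ψ - (z.im - ψ) * Real.sin ψ ≤
      |z.re| + |z.im| + |ψ| - τ * Real.cos ψ := by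
    linarith
  gcongr

/-- Super-exponential decay of Newman's kernel to the right: if
`|Re z| + |Im z| + |ψ| + 2 ≤ τ cos ψ` then `‖K(z, τ + iψ)‖ ≤ e^{-τ}`. [folklore] -/
theorem newmanRotate_norm_le_exp_neg (z : ℂ) {τ ψ : ℝ}
    (h : |z.re| + |z.im| + |ψ| + 2 ≤ τ * Real.cos ψ) :
    ‖Complex.exp (z * Complex.exp ((τ : ℂ) + ψ * I) -
        ((τ : ℂ) + ψ * I) * Complex.exp ((τ : ℂ) + ψ * I) + ((τ : ℂ) + ψ * I))‖ ≤ Real.exp (-τ) := by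
  refine (newmanRotate_norm_kernel_le z τ ψ).trans ?_
  rw [Real.exp_le_exp]
  have h1 : Real.exp τ * (|z.re| + |z.im| + |ψ| - τ * Real.cos ψ) ≤ Real.exp τ * (-2) :=
    mul_le_mul_of_nonneg_left (by linarith) (Real.exp_pos τ).le
  have h2 : τ + 1 ≤ Real.exp τ := Real.add_one_le_exp τ
  linarith

/-- Exponential decay of Newman's kernel to the left: for `τ ≤ 0`,
`‖K(z, τ + iψ)‖ ≤ exp(|Re z| + |Im z| + |ψ| + 1 + τ)`. [folklore] -/
theorem newmanRotate_norm_le_exp (z : ℂ) {τ : ℝ} (hτ : τ ≤ 0) (ψ : ℝ) :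
    ‖Complex.exp (z * Complex.exp ((τ : ℂ) + ψ * I) -
        ((τ : ℂ) + ψ * I) * Complex.exp ((τ : ℂ) + ψ * I) + ((τ : ℂ) + ψ * I))‖ ≤
      Real.exp (|z.re| + |z.im| + |ψ| + 1 + τ) := by
  refine (newmanRotate_norm_kernel_le z τ ψ).trans ?_
  rw [Real.exp_le_exp]
  have hM : 0 ≤ |z.re| + |z.im| + |ψ| := by positivity
  have he1 : Real.exp τ ≤ 1 := Real.exp_le_one_iff.mpr hτ
  have h6 : Real.exp τ * (-(τ * Real.cos ψ)) ≤ 1 := by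
    have h6a : -(τ * Real.cos ψ) ≤ -τ := by
      calc -(τ * Real.cos ψ) ≤ |-(τ * Real.cos ψ)| := le_abs_self _
        _ = |τ| * |Real.cos ψ| := by rw [abs_neg, abs_mul]
        _ ≤ |τ| * 1 := by gcongr; exact Real.abs_cos_le_one ψ
        _ = -τ := by rw [mul_one, abs_of_nonpos hτ]
    have h6b : -τ ≤ Real.exp (-τ) := by linarith [Real.add_one_le_exp (-τ)]
    calc Real.exp τ * (-(τ * Real.cos ψ)) ≤ Real.exp τ * (-τ) := by gcongr
      _ ≤ Real.exp τ * Real.exp (-τ) := by gcongr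
      _ = 1 := by rw [← Real.exp_add]; simp
  have h7 : Real.exp τ * (|z.re| + |z.im| + |ψ|) ≤ |z.re| + |z.im| + |ψ| := by
    calc Real.exp τ * (|z.re| + |z.im| + |ψ|) ≤ 1 * (|z.re| + |z.im| + |ψ|) := by gcongr
      _ = _ := one_mul _
  linarith

/-! ## Integrability on horizontal lines and decay of the vertical sides -/

/-- Newman's kernel is integrable along every horizontal line `Im ζ = ψ` with `cos ψ > 0`. [folklore] -/
theorem newmanRotate_integrable (z : ℂ) {ψ : ℝ} (hψ : 0 < Real.cos ψ) :
    Integrable (fun τ : ℝ => Complex.exp (z * Complex.exp ((τ : ℂ) + ψ * I) -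
        ((τ : ℂ) + ψ * I) * Complex.exp ((τ : ℂ) + ψ * I) + ((τ : ℂ) + ψ * I))) := by
  set M : ℝ := |z.re| + |z.im| + |ψ| with hM
  have hM0 : 0 ≤ M := by positivity
  set T₁ : ℝ := (M + 2) / Real.cos ψ with hT₁
  have hcont : Continuous (fun τ : ℝ => Complex.exp (z * Complex.exp ((τ : ℂ) + ψ * I) -
      ((τ : ℂ) + ψ * I) * Complex.exp ((τ : ℂ) + ψ * I) + ((τ : ℂ) + ψ * I))) := by
    fun_prop
  have h1 : IntegrableOn (fun τ : ℝ => Complex.exp (z * Complex.exp ((τ : ℂ) + ψ * I) -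
      ((τ : ℂ) + ψ * I) * Complex.exp ((τ : ℂ) + ψ * I) + ((τ : ℂ) + ψ * I))) (Iic 0) := by
    have hg : IntegrableOn (fun τ : ℝ => Real.exp (M + 1) * Real.exp τ) (Iic 0) :=
      Integrable.const_mul (integrableOn_exp_Iic 0) _
    refine Integrable.mono' hg hcont.aestronglyMeasurable ?_
    refine ae_restrict_of_forall_mem measurableSet_Iic fun τ hτ => ?_
    rw [← Real.exp_add]
    exact newmanRotate_norm_le_exp z hτ ψ
  have h2 : IntegrableOn (fun τ : ℝ => Complex.exp (z * Complex.exp ((τ : ℂ) + ψ * I) -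
      ((τ : ℂ) + ψ * I) * Complex.exp ((τ : ℂ) + ψ * I) + ((τ : ℂ) + ψ * I))) (Icc 0 T₁) :=
    hcont.integrableOn_Icc
  have h3 : IntegrableOn (fun τ : ℝ => Complex.exp (z * Complex.exp ((τ : ℂ) + ψ * I) -
      ((τ : ℂ) + ψ * I) * Complex.exp ((τ : ℂ) + ψ * I) + ((τ : ℂ) + ψ * I))) (Ioi T₁) := by
    have hg : IntegrableOn (fun τ : ℝ => Real.exp (-τ)) (Ioi T₁) := integrableOn_exp_neg_Ioi T₁
    refine Integrable.mono' hg hcont.aestronglyMeasurable ?_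
    refine ae_restrict_of_forall_mem measurableSet_Ioi fun τ hτ => ?_
    refine newmanRotate_norm_le_exp_neg z ?_
    have e1 : T₁ * Real.cos ψ = M + 2 := div_mul_cancel₀ _ hψ.ne'
    have e2 : T₁ * Real.cos ψ ≤ τ * Real.cos ψ := mul_le_mul_of_nonneg_right (le_of_lt hτ) hψ.le
    linarith
  rw [← integrableOn_univ]
  refine ((h1.union h2).union h3).mono_set fun τ _ => ?_
  rcases le_or_gt τ 0 with h | h
  · exact Or.inl (Or.inl h)
  · rcases le_or_gt τ T₁ with h' | h'
    · exact Or.inl (Or.inr ⟨h.le, h'⟩)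
    · exact Or.inr h'

/-- The integral of Newman's kernel over the right vertical side `T + i[0, φ]` of the rectangle
`[-T, T] × [0, φ]` tends to `0` as `T → +∞`, for `|φ| < π / 2`. [folklore] -/
theorem newmanRotate_tendsto_right (z : ℂ) {φ : ℝ} (hφ : φ ∈ Set.Ioo (-(π / 2)) (π / 2)) :
    Tendsto (fun T : ℝ => ∫ y : ℝ in (0 : ℝ)..φ, Complex.exp (z * Complex.exp ((T : ℂ) + y * I) -
        ((T : ℂ) + y * I) * Complex.exp ((T : ℂ) + y * I) + ((T : ℂ) + y * I))) atTop (𝓝 0) := by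
  have hc : 0 < Real.cos φ := Real.cos_pos_of_mem_Ioo hφ
  have hφπ : |φ| ≤ π := by
    have : |φ| < π / 2 := abs_lt.mpr ⟨hφ.1, hφ.2⟩
    linarith [Real.pi_pos]
  rw [tendsto_zero_iff_norm_tendsto_zero]
  have hbound : ∀ᶠ T : ℝ in atTop,
      ‖∫ y : ℝ in (0 : ℝ)..φ, Complex.exp (z * Complex.exp ((T : ℂ) + y * I) -
        ((T : ℂ) + y * I) * Complex.exp ((T : ℂ) + y * I) + ((T : ℂ) + y * I))‖ ≤
          Real.exp (-T) * |φ| := by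
    filter_upwards [eventually_ge_atTop ((|z.re| + |z.im| + |φ| + 2) / Real.cos φ),
      eventually_ge_atTop (0 : ℝ)] with T hT hT0
    have key : ∀ y ∈ Set.uIoc (0 : ℝ) φ, ‖Complex.exp (z * Complex.exp ((T : ℂ) + y * I) -
        ((T : ℂ) + y * I) * Complex.exp ((T : ℂ) + y * I) + ((T : ℂ) + y * I))‖ ≤ Real.exp (-T) := by
      intro y hy
      have hyφ : |y| ≤ |φ| := by simpa using abs_sub_left_of_mem_uIcc (uIoc_subset_uIcc hy)
      have hcos : Real.cos φ ≤ Real.cos y := by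
        rw [← Real.cos_abs φ, ← Real.cos_abs y]
        exact Real.cos_le_cos_of_nonneg_of_le_pi (abs_nonneg y) hφπ hyφ
      refine newmanRotate_norm_le_exp_neg z ?_
      have e1 : (|z.re| + |z.im| + |φ| + 2) / Real.cos φ * Real.cos φ = |z.re| + |z.im| + |φ| + 2 :=
        div_mul_cancel₀ _ hc.ne'
      have e2 : (|z.re| + |z.im| + |φ| + 2) / Real.cos φ * Real.cos φ ≤ T * Real.cos φ :=
        mul_le_mul_of_nonneg_right hT hc.le
      have e3 : T * Real.cos φ ≤ T * Real.cos y := mul_le_mul_of_nonneg_left hcos hT0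
      linarith
    simpa using intervalIntegral.norm_integral_le_of_norm_le_const key
  refine squeeze_zero' (Eventually.of_forall fun T => norm_nonneg _) hbound ?_
  simpa using Real.tendsto_exp_neg_atTop_nhds_zero.mul_const |φ|

/-- The integral of Newman's kernel over the left vertical side `-T + i[0, φ]` of the rectangle
`[-T, T] × [0, φ]` tends to `0` as `T → +∞` (for every real `φ`). [folklore] -/
theorem newmanRotate_tendsto_left (z : ℂ) (φ : ℝ) :
    Tendsto (fun T : ℝ => ∫ y : ℝ in (0 : ℝ)..φ, Complex.exp (z * Complex.exp (-(T : ℂ) + y * I) -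
        (-(T : ℂ) + y * I) * Complex.exp (-(T : ℂ) + y * I) + (-(T : ℂ) + y * I))) atTop (𝓝 0) := by
  rw [tendsto_zero_iff_norm_tendsto_zero]
  have hbound : ∀ᶠ T : ℝ in atTop,
      ‖∫ y : ℝ in (0 : ℝ)..φ, Complex.exp (z * Complex.exp (-(T : ℂ) + y * I) -
        (-(T : ℂ) + y * I) * Complex.exp (-(T : ℂ) + y * I) + (-(T : ℂ) + y * I))‖ ≤
          Real.exp (|z.re| + |z.im| + |φ| + 1 + -T) * |φ| := by
    filter_upwards [eventually_ge_atTop (0 : ℝ)] with T hT0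
    have key : ∀ y ∈ Set.uIoc (0 : ℝ) φ, ‖Complex.exp (z * Complex.exp (-(T : ℂ) + y * I) -
        (-(T : ℂ) + y * I) * Complex.exp (-(T : ℂ) + y * I) + (-(T : ℂ) + y * I))‖ ≤
          Real.exp (|z.re| + |z.im| + |φ| + 1 + -T) := by
      intro y hy
      have hyφ : |y| ≤ |φ| := by simpa using abs_sub_left_of_mem_uIcc (uIoc_subset_uIcc hy)
      have h := newmanRotate_norm_le_exp z (τ := -T) (by linarith) y
      rw [ofReal_neg] at h
      refine h.trans ?_
      rw [Real.exp_le_exp]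
      linarith
    simpa using intervalIntegral.norm_integral_le_of_norm_le_const key
  refine squeeze_zero' (Eventually.of_forall fun T => norm_nonneg _) hbound ?_
  have h : Tendsto (fun T : ℝ => Real.exp (|z.re| + |z.im| + |φ| + 1 + -T) * |φ|) atTop
      (𝓝 (0 * |φ|)) := by
    refine Tendsto.mul_const _ (Real.tendsto_exp_atBot.comp ?_)
    exact tendsto_atBot_add_const_left _ _ tendsto_neg_atTop_atBot
  simpa using h

/-! ## The contour shift -/

/-- Abstract contour shift: an entire `f`, integrable on `ℝ` and on `ℝ + iφ`, whose integrals over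
the vertical segments `±T + i[0, φ]` tend to `0` as `T → +∞`, has `∫ f(x) dx = ∫ f(x + iφ) dx`
(Cauchy–Goursat on the rectangles `[-T, T] × [0, φ]`, then `T → ∞`). [folklore] -/
theorem newmanRotate_shift (f : ℂ → ℂ) (hd : Differentiable ℂ f) (φ : ℝ)
    (h0 : Integrable fun x : ℝ => f x) (hφ : Integrable fun x : ℝ => f (x + φ * I))
    (hright : Tendsto (fun T : ℝ => ∫ y : ℝ in (0 : ℝ)..φ, f (T + y * I)) atTop (𝓝 0))
    (hleft : Tendsto (fun T : ℝ => ∫ y : ℝ in (0 : ℝ)..φ, f (-T + y * I)) atTop (𝓝 0)) :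
    ∫ x : ℝ, f x = ∫ x : ℝ, f (x + φ * I) := by
  have C : ∀ T : ℝ, (∫ x : ℝ in -T..T, f x) = (∫ x : ℝ in -T..T, f (x + φ * I)) -
      I * (∫ y : ℝ in (0 : ℝ)..φ, f (T + y * I)) + I * (∫ y : ℝ in (0 : ℝ)..φ, f (-T + y * I)) := by
    intro T
    have h := integral_boundary_rect_eq_zero_of_differentiableOn f (-T) (T + φ * I)
      hd.differentiableOn
    simp only [neg_re, ofReal_re, neg_im, ofReal_im, neg_zero, add_re, mul_re, I_re, I_im, mul_zero,
      mul_one, sub_self, add_zero, add_im, mul_im, zero_add, ofReal_zero, zero_mul,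
      ofReal_neg, smul_eq_mul] at h
    linear_combination h
  have hlim : Tendsto (fun T : ℝ => ∫ x : ℝ in -T..T, f x) atTop (𝓝 (∫ x : ℝ, f (x + φ * I))) := by
    have h1 := ((intervalIntegral_tendsto_integral hφ tendsto_neg_atTop_atBot tendsto_id).sub
      (hright.const_mul I)).add (hleft.const_mul I)
    simp only [id, mul_zero, sub_zero, add_zero] at h1
    exact h1.congr fun T => (C T).symm
  exact tendsto_nhds_unique
    (intervalIntegral_tendsto_integral h0 tendsto_neg_atTop_atBot tendsto_id) hlim

/-- **Stub 2 of the line (shift of the line of integration).** For `|φ| < π/2` and every `z`,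
`∫_ℝ K(z, t) dt = ∫_ℝ K(z, t + iφ) dt` for Newman's entire kernel `K(z, ζ) = exp(z e^ζ - ζ e^ζ + ζ)`
(Cauchy–Goursat on the rectangles `[-T, T] × [0, φ]`, whose vertical sides vanish as `T → ∞` since
`|K(z, τ + iψ)| = exp(e^τ((Re z - τ) cos ψ - (Im z - ψ) sin ψ) + τ)`). In the variable `s = e^ζ` this is
the rotation of the ray of integration of `∫₀^∞ e^{zs} s^{-s} ds`; D. J. Newman, Amer. Math. Monthly 83
(1976) 192–193. [folklore] -/
theorem stub_newmanRotate (φ : ℝ) (hφ : φ ∈ Set.Ioo (-(π / 2)) (π / 2)) (z : ℂ) :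
    (∫ τ : ℝ, Complex.exp (z * Complex.exp (τ : ℂ) - (τ : ℂ) * Complex.exp (τ : ℂ) + (τ : ℂ))) =
      ∫ τ : ℝ, Complex.exp (z * Complex.exp ((τ : ℂ) + φ * I) -
        ((τ : ℂ) + φ * I) * Complex.exp ((τ : ℂ) + φ * I) + ((τ : ℂ) + φ * I)) := by
  have h0 : Integrable fun τ : ℝ =>
      Complex.exp (z * Complex.exp (τ : ℂ) - (τ : ℂ) * Complex.exp (τ : ℂ) + (τ : ℂ)) := by
    simpa using newmanRotate_integrable z (ψ := 0) (by rw [Real.cos_zero]; exact one_pos)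
  exact newmanRotate_shift (fun ζ => Complex.exp (z * Complex.exp ζ - ζ * Complex.exp ζ + ζ))
    (by fun_prop) φ h0 (newmanRotate_integrable z (Real.cos_pos_of_mem_Ioo hφ))
    (newmanRotate_tendsto_right z hφ) (newmanRotate_tendsto_left z φ)

end PotentialFlow
end MarginalStabilityChainStretchedVortexRows
end Summit.AnomalousDissipation.AnomalousDissipation.Theorems
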